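import Literature.Computability.Cryptography.LWEModulusSwitchSamples
import Literature.Computability.Cryptography.LWENoiseJitterSample
import Literature.Computability.Cryptography.LWETorusDiscretize
import Literature.Computability.Cryptography.LWETorusPostprocess
import Literature.Algebra.EuclideanLattices.StatDistBind
import Literature.Computability.Cryptography.IndepLawBridge
import Literature.Computability.Cryptography.LWEPrimePowerRounding
import Literature.Probability.Distributions.IndepProductLawMeasure
import HarnessLib

/-!
# BLPRS 2013, Cor. 3.2 between DISCRETISED interfaces: `Ψ̄`-samples mod `Q` ↦ `Ψ̄`-samples mod `q'` (one sample)

Topic `Computability/Cryptography` (LWE), grouping namespace `BLPRS2013`. Proved glue (no named fact)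
towards `Literature.Computability.Cryptography.blprs_gapSVP_sqrt_dim_to_lwe_classical` (**pqc.S21**),
hypothesis `h₃` of `BLPRSReduction.lean`: the modulus switch of Lemma 3.5 / Cor. 3.2
(`LWEModulusSwitch.lean`, torus samples `ℤ_Qⁿ × 𝕋 → ℤ_{q'}ⁿ × 𝕋`) conjugated by the two exact-or-almost
exact interface changes of the tree — re-continuisation of a discretised sample
(`LWENoiseJitterSample.lean`: `U ↦ U` exactly, `A_{s,Ψ̄_α} ↦` within `2/(αQ)` of `A_{s,Ψ_α}`) and
discretisation (`LWETorusDiscretize.lean`: `U ↦ U`, `A_{s,Ψ_{α'}} ↦ A_{s,Ψ̄_{α'}}` exactly), with the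
exact post-processing of `LWETorusPostprocess.lean` (secret shift `t` and noise raising `τ`:
`A_{s,Ψ_{α'}} ↦ A_{s+t,Ψ_{√(α'²+τ²)}}`, `U ↦ U`) in between — so that the reduction acts on the DISCRETISED
samples `ℤ_Qⁿ × ℤ_Q → ℤ_{q'}ⁿ × ℤ_{q'}` of the tree's decision-LWE interfaces (the format of
`BLPRSThm41Skeleton.lean`'s tests):
* `switchDisc`, `switchSample` — the one-sample chain (re-continuise, switch, post-process, discretise);
* **`statDist_switchSample_uniform_le`** — a uniform sample mod `Q` goes to within `4ε` of a uniform
  sample mod `q'` (Lemma 3.5 (i));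
* **`statDist_switchSample_lwe_le`** — `A_{s,Ψ̄_α}` mod `Q` goes to within `2/(αQ) + 10ε` of
  `A_{s+t,Ψ̄_{√(α'²+τ²)}}` mod `q'`, `α'² = α² + r²(‖s‖² + B²)` (Lemma 3.5 (ii) + the interfaces, data
  processing through the kernels `statDist_bind_le`);
* `switchOutputs` (`m` samples), **`statDist_switchOutputs_uniform_le`** (`4εm`), `lweMix` (the law
  `LWE_{n,m,·,≤}(ζ)` of discretised samples with an integer secret law `ζ` and secret-dependent rates),
  **`statDist_switchOutputs_lwe_le`** (`m(2/(α₀Q) + 10ε)`), the composed test `switchTest`,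
  **`advantage_transfer`** and **`corollary_3_2_discrete`** (advantage form).

## References

* Z. Brakerski, A. Langlois, C. Peikert, O. Regev, D. Stehlé, *Classical hardness of learning with
  errors*, STOC 2013; arXiv:1306.0281, §3, Lemma 3.5 and Cor. 3.2; §2.3 (discretised `Ψ̄`). [BrakerskiEtAl2013]
* O. Regev, *On lattices, learning with errors …*, J. ACM 56 (2009), Lemma 4.3 (discretisation). [RegevLWE2009]
-/

noncomputable section

open MeasureTheory ProbabilityTheory Literature.Algebra.EuclideanLattices Literature.Probability.Distributions
open scoped Real ENNReal NNReal

namespace Literature.Computability.Cryptography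

namespace BLPRS2013

section Single

variable (n Q q' : ℕ) [NeZero Q] [NeZero q'] (r B τ : ℝ) (t : Fin n → ZMod q')

/-- **Switch, post-process, discretise** one torus sample: Lemma 3.5's output, shifted by `⟨a,t⟩/q'` with
extra `Ψ_τ` noise, rounded to `ℤ_{q'}`. [cite: BrakerskiEtAl2013, Lemma 3.5 and Lemma 2.15; RegevLWE2009, Lemma 4.3] -/
def switchDisc (μ : Measure ((Fin n → ZMod Q) × UnitAddCircle)) : Measure ((Fin n → ZMod q') × ZMod q') :=
  (postOutput n q' τ t (modSwitchOutput (q' := q') r B μ)).map (LWE.discretizeSample q')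

/-- **The one-sample chain on a discretised sample law**: re-continuise, switch, discretise. [cite: BrakerskiEtAl2013, Cor. 3.2] -/
def switchSample (P : PMF ((Fin n → ZMod Q) × ZMod Q)) : Measure ((Fin n → ZMod q') × ZMod q') :=
  switchDisc n Q q' r B τ t (LWE.recont Q P)

/-- The chain outputs a probability measure. [folklore] -/
instance isProbabilityMeasure_switchDisc (μ : Measure ((Fin n → ZMod Q) × UnitAddCircle)) [IsProbabilityMeasure μ] :
    IsProbabilityMeasure (switchDisc n Q q' r B τ t μ) :=
  Measure.isProbabilityMeasure_map (LWE.measurable_discretizeSample q').aemeasurable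

/-- The chain outputs a probability measure. [folklore] -/
instance isProbabilityMeasure_switchSample (P : PMF ((Fin n → ZMod Q) × ZMod Q)) : IsProbabilityMeasure (switchSample n Q q' r B τ t P) := by
  unfold switchSample; infer_instance

variable {n Q q' r B τ t}

/-- **Data processing through the chain**: `Δ(switchDisc μ, switchDisc ν) ≤ Δ(μ, ν)`. [folklore] -/
theorem statDist_switchDisc_le (μ ν : Measure ((Fin n → ZMod Q) × UnitAddCircle)) [IsProbabilityMeasure μ] [IsProbabilityMeasure ν] :
    statDist (switchDisc n Q q' r B τ t μ) (switchDisc n Q q' r B τ t ν) ≤ statDist μ ν :=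
  (statDist_map_le (LWE.measurable_discretizeSample q') _ _).trans
    ((statDist_bind_le measurable_postKernel _ _).trans (statDist_bind_le (measurable_modSwitchKernel r B) μ ν))

/-- **A uniform discretised sample mod `Q` goes to within `4ε` of a uniform discretised sample mod `q'`.**
[cite: BrakerskiEtAl2013, Lemma 3.5 (first property)] -/
theorem statDist_switchSample_uniform_le {ε : ℝ} (hn : 0 < n) (hε : 0 < ε) (hε' : ε ≤ 1 / 2)
    (hr : max (Q : ℝ)⁻¹ (q' : ℝ)⁻¹ * Real.sqrt (2 * Real.log (2 * n * (1 + 1 / ε)) / π) ≤ r) :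
    statDist (switchSample n Q q' r B τ t (PMF.uniformOfFintype ((Fin n → ZMod Q) × ZMod Q)))
      (PMF.uniformOfFintype ((Fin n → ZMod q') × ZMod q')).toMeasure ≤ 4 * ε := by
  rw [switchSample, LWE.recont_uniform, switchDisc, ← LWE.uniform_prod_volume_map_discretizeSample]
  change statDist ((postOutput n q' τ t (modSwitchOutput (q' := q') r B (uniformInput n Q))).map (LWE.discretizeSample q'))
    ((uniformInput n q').map (LWE.discretizeSample q')) ≤ _
  refine (statDist_map_le (LWE.measurable_discretizeSample q') _ _).trans ?_
  rw [← postOutput_uniformInput (τ := τ) (t := t)]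
  exact (statDist_bind_le measurable_postKernel _ _).trans (statDist_modSwitchOutput_uniform_le B hn hε hε' hr)

/-- **An `A_{s,Ψ̄_α}` sample mod `Q` goes to within `2/(αQ) + 10ε` of an `A_{s,Ψ̄_{α'}}` sample mod `q'`**,
`α'² = α² + r²(‖s‖² + B²)`, for an integer secret `s` with `‖s‖ ≤ B`. [cite: BrakerskiEtAl2013, Lemma 3.5 (second property) and Cor. 3.2] -/
theorem statDist_switchSample_lwe_le {ε α : ℝ} (hn : 0 < n) (hε : 0 < ε) (hε' : ε ≤ 1 / 2)
    (hr : max (Q : ℝ)⁻¹ (q' : ℝ)⁻¹ * Real.sqrt (2 * Real.log (2 * n * (1 + 1 / ε)) / π) ≤ r)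
    (hα : 0 < α) (s : Fin n → ℤ) (hsB : ‖intVecToEuclidean n s‖ ≤ B) :
    statDist (switchSample n Q q' r B τ t (LWE.lweSample (LWE.discretizedGaussian Q α) fun j => (s j : ZMod Q)))
      (LWE.lweSample (LWE.discretizedGaussian q' (Real.sqrt (Real.sqrt (α ^ 2 + r ^ 2 * (‖intVecToEuclidean n s‖ ^ 2 + B ^ 2)) ^ 2 + τ ^ 2)))
        ((fun j => (s j : ZMod q')) + t)).toMeasure ≤
      2 / (α * Q) + 10 * ε := by
  rw [switchSample, ← LWE.torusLWESample_wrappedGaussian_map_discretizeSample, ← postOutput_torusLWESample]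
  refine (statDist_triangle _ (switchDisc n Q q' r B τ t (LWE.torusLWESample Q (LWE.wrappedGaussian α) fun j => (s j : ZMod Q))) _).trans ?_
  refine add_le_add ?_ ?_
  · exact (statDist_switchDisc_le _ _).trans (LWE.statDist_recont_lweSample_torusLWESample_le Q hα _)
  · rw [switchDisc]
    refine (statDist_map_le (LWE.measurable_discretizeSample q') _ _).trans ?_
    exact (statDist_bind_le measurable_postKernel _ _).trans (statDist_modSwitchOutput_lwe_le hn hε hε' hr hα s hsB)

end Single

/-! ### The chain as a kernel on discretised samples, `m` samples at once -/

section Many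

variable (n Q q' : ℕ) [NeZero Q] [NeZero q'] (r B τ : ℝ) (t : Fin n → ZMod q')

/-- **The point kernel of the chain**: on one discretised sample, re-continuise, switch, discretise. [cite: BrakerskiEtAl2013, Cor. 3.2] -/
def switchPoint (x : (Fin n → ZMod Q) × ZMod Q) : Measure ((Fin n → ZMod q') × ZMod q') :=
  switchDisc n Q q' r B τ t (LWE.recontKernel Q x)

/-- The point kernel is Markov. [folklore] -/
instance isProbabilityMeasure_switchPoint (x : (Fin n → ZMod Q) × ZMod Q) : IsProbabilityMeasure (switchPoint n Q q' r B τ t x) := by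
  unfold switchPoint; infer_instance

variable {n Q q' r B τ t}

/-- The point kernel is measurable (countable source). [folklore] -/
theorem measurable_switchPoint : Measurable (switchPoint n Q q' r B τ t) := measurable_of_countable _

/-- A map of a countable mixture is the mixture of the maps. [folklore] -/
theorem map_sum_smul {X Y Z : Type*} [MeasurableSpace Y] [MeasurableSpace Z] (w : X → ℝ≥0∞) (μ : X → Measure Y) {f : Y → Z} (hf : Measurable f) :
    (Measure.sum fun x => w x • μ x).map f = Measure.sum fun x => w x • (μ x).map f := by
  ext S hS
  rw [Measure.map_apply hf hS, Measure.sum_apply _ (hf hS), Measure.sum_apply _ hS]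
  refine tsum_congr fun x => ?_
  rw [Measure.smul_apply, Measure.smul_apply, Measure.map_apply hf hS]

/-- **The law-level chain is the bind with the point kernel.** [folklore] -/
theorem toMeasure_bind_switchPoint (P : PMF ((Fin n → ZMod Q) × ZMod Q)) :
    P.toMeasure.bind (switchPoint n Q q' r B τ t) = switchSample n Q q' r B τ t P := by
  have h1 : P.toMeasure.bind (switchPoint n Q q' r B τ t) = Measure.sum fun x => P x • switchPoint n Q q' r B τ t x := by
    ext S hS
    rw [Measure.bind_apply hS measurable_switchPoint.aemeasurable, lintegral_countable', Measure.sum_apply _ hS]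
    refine tsum_congr fun x => ?_
    rw [PMF.toMeasure_apply_singleton _ _ (measurableSet_singleton _), Measure.smul_apply, smul_eq_mul, mul_comm]
  have h2 : LWE.recont Q P = Measure.sum fun x => P x • LWE.recontKernel Q x := by
    ext S hS
    rw [LWE.recont, Measure.bind_apply hS (measurable_of_countable _).aemeasurable, lintegral_countable', Measure.sum_apply _ hS]
    refine tsum_congr fun x => ?_
    rw [PMF.toMeasure_apply_singleton _ _ (measurableSet_singleton _), Measure.smul_apply, smul_eq_mul, mul_comm]
  rw [h1, switchSample, switchDisc, modSwitchOutput, h2, sum_smul_bind _ _ (measurable_modSwitchKernel r B), postOutput,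
    sum_smul_bind _ _ measurable_postKernel, map_sum_smul _ _ (LWE.measurable_discretizeSample q')]
  rfl

end Many

/-! ### `m` samples at once: products and mixtures over the secret -/

section Outputs

variable (n Q q' : ℕ) [NeZero Q] [NeZero q'] (r B τ : ℝ) (t : Fin n → ZMod q') (m : ℕ)

/-- **The reduction on `m` discretised samples**: the point kernel applied independently to every sample.
[cite: BrakerskiEtAl2013, Thm. 3.1 / Cor. 3.2 ("transformation reduction")] -/
def switchOutputs (S : PMF (Fin m → (Fin n → ZMod Q) × ZMod Q)) : Measure (Fin m → (Fin n → ZMod q') × ZMod q') :=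
  S.toMeasure.bind (piKernel (switchPoint n Q q' r B τ t) m)

/-- The outputs form a probability measure. [folklore] -/
instance isProbabilityMeasure_switchOutputs (S : PMF (Fin m → (Fin n → ZMod Q) × ZMod Q)) : IsProbabilityMeasure (switchOutputs n Q q' r B τ t m S) := by
  constructor
  rw [switchOutputs, Measure.bind_apply MeasurableSet.univ (measurable_piKernel measurable_switchPoint m).aemeasurable]
  simp

variable {n Q q' r B τ t m}

/-- The measure of an iid tuple is the product measure. [folklore] -/
theorem toMeasure_iidPMF {X : Type} [MeasurableSpace X] [MeasurableSingletonClass X] [Countable X] (P : PMF X) (m : ℕ) :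
    (LWE.iidPMF P m).toMeasure = Measure.pi fun _ : Fin m => P.toMeasure := by
  rw [← LWE.indepLaw_const, toMeasure_indepLaw]

/-- **On `m` iid samples the outputs are the `m`-fold power of the one-sample chain.** [folklore] -/
theorem switchOutputs_iidPMF (P : PMF ((Fin n → ZMod Q) × ZMod Q)) :
    switchOutputs n Q q' r B τ t m (LWE.iidPMF P m) = Measure.pi fun _ : Fin m => switchSample n Q q' r B τ t P := by
  rw [switchOutputs, toMeasure_iidPMF, pi_bind_piKernel measurable_switchPoint]
  simp_rw [toMeasure_bind_switchPoint]

/-- The measure of a mixture of PMFs is the mixture of the measures. [folklore] -/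
theorem toMeasure_bind_eq_sum' {X Y : Type*} [MeasurableSpace Y] [MeasurableSingletonClass Y] (ζ : PMF X) (f : X → PMF Y) :
    (ζ.bind f).toMeasure = Measure.sum fun x => ζ x • (f x).toMeasure := by
  ext S hS
  rw [PMF.toMeasure_apply_eq_toOuterMeasure_apply _ hS, PMF.toOuterMeasure_bind_apply, Measure.sum_apply _ hS]
  refine tsum_congr fun x => ?_
  rw [Measure.smul_apply, smul_eq_mul, PMF.toMeasure_apply_eq_toOuterMeasure_apply _ hS]

/-- **On a mixture over the secret of iid samples the outputs are the same mixture of powers.** [folklore] -/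
theorem switchOutputs_mix {Z : Type*} (ζ : PMF Z) (P : Z → PMF ((Fin n → ZMod Q) × ZMod Q)) :
    switchOutputs n Q q' r B τ t m (ζ.bind fun z => LWE.iidPMF (P z) m) =
      Measure.sum fun z => ζ z • Measure.pi fun _ : Fin m => switchSample n Q q' r B τ t (P z) := by
  rw [switchOutputs, toMeasure_bind_eq_sum', sum_smul_bind _ _ (measurable_piKernel measurable_switchPoint m)]
  congr 1
  funext z
  rw [← switchOutputs, switchOutputs_iidPMF]

/-- **The uniform side, `m` samples**: `Δ ≤ 4εm`. [cite: BrakerskiEtAl2013, Thm. 3.1 (uniform side)] -/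
theorem statDist_switchOutputs_uniform_le {ε : ℝ} (hn : 0 < n) (hε : 0 < ε) (hε' : ε ≤ 1 / 2)
    (hr : max (Q : ℝ)⁻¹ (q' : ℝ)⁻¹ * Real.sqrt (2 * Real.log (2 * n * (1 + 1 / ε)) / π) ≤ r) :
    statDist (switchOutputs n Q q' r B τ t m (LWE.uniformSamples (Fin n) (ZMod Q) m)) (LWE.uniformSamples (Fin n) (ZMod q') m).toMeasure ≤ m * (4 * ε) := by
  rw [LWE.uniformSamples, LWE.uniformSamples, ← LWE.MP12.iidPMF_uniformOfFintype, ← LWE.MP12.iidPMF_uniformOfFintype, switchOutputs_iidPMF,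
    toMeasure_iidPMF]
  refine (statDist_pi_le_sum _ _).trans ?_
  rw [Finset.sum_const, Finset.card_univ, Fintype.card_fin, nsmul_eq_mul]
  exact mul_le_mul_of_nonneg_left (statDist_switchSample_uniform_le hn hε hε' hr) (Nat.cast_nonneg m)

variable (Q m) in
/-- **`LWE_{n,m,Q,≤α}(ζ)` on discretised samples, secret shifted by `t₀`**: `z ← ζ` (integer secret), then
`m` iid samples of `A_{(z mod Q) + t₀, Ψ̄_{rate z}}`. [cite: BrakerskiEtAl2013, Def. 2.11 / Def. 2.14 with §2.3 (Ψ̄)] -/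
def lweMix (ζ : PMF (Fin n → ℤ)) (rate : (Fin n → ℤ) → ℝ) (t₀ : Fin n → ZMod Q) : PMF (Fin m → (Fin n → ZMod Q) × ZMod Q) :=
  ζ.bind fun z => LWE.lweSamples (LWE.discretizedGaussian Q (rate z)) ((fun j => (z j : ZMod Q)) + t₀) m

/-- **The LWE side, `m` samples**: for a secret law supported on `‖z‖ ≤ B` and rates in `[α₀, ∞)`, the outputs
are within `m(2/(α₀Q) + 10ε)` of `LWE_{n,m,q',≤β}(ζ)` with the switched rates `√(rate² + r²(‖z‖² + B²))`.
[cite: BrakerskiEtAl2013, Cor. 3.2] -/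
theorem statDist_switchOutputs_lwe_le {ε α₀ : ℝ} (hn : 0 < n) (hε : 0 < ε) (hε' : ε ≤ 1 / 2)
    (hr : max (Q : ℝ)⁻¹ (q' : ℝ)⁻¹ * Real.sqrt (2 * Real.log (2 * n * (1 + 1 / ε)) / π) ≤ r) (hα₀ : 0 < α₀)
    (ζ : PMF (Fin n → ℤ)) (rate : (Fin n → ℤ) → ℝ) (hrate : ∀ z ∈ ζ.support, α₀ ≤ rate z)
    (hB : ∀ z ∈ ζ.support, ‖intVecToEuclidean n z‖ ≤ B) :
    statDist (switchOutputs n Q q' r B τ t m (lweMix Q m ζ rate 0))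
      (lweMix q' m ζ (fun z => Real.sqrt (Real.sqrt (rate z ^ 2 + r ^ 2 * (‖intVecToEuclidean n z‖ ^ 2 + B ^ 2)) ^ 2 + τ ^ 2)) t).toMeasure ≤
      m * (2 / (α₀ * Q) + 10 * ε) := by
  rw [lweMix, lweMix]
  simp only [LWE.lweSamples, add_zero]
  rw [switchOutputs_mix, toMeasure_bind_eq_sum']
  simp_rw [toMeasure_iidPMF]
  refine (statDist_sum_smul_le _ ζ.tsum_coe _ _).trans ?_
  -- every secret in the support contributes at most `m (2/(α₀ Q) + 10 ε)`
  have hz : ∀ z, ζ z * ENNReal.ofReal (statDist (Measure.pi fun _ : Fin m => switchSample n Q q' r B τ t (LWE.lweSample (LWE.discretizedGaussian Q (rate z)) fun j => (z j : ZMod Q)))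
      (Measure.pi fun _ : Fin m => (LWE.lweSample (LWE.discretizedGaussian q' (Real.sqrt (Real.sqrt (rate z ^ 2 + r ^ 2 * (‖intVecToEuclidean n z‖ ^ 2 + B ^ 2)) ^ 2 + τ ^ 2)))
        ((fun j => (z j : ZMod q')) + t)).toMeasure)) ≤
      ζ z * ENNReal.ofReal (m * (2 / (α₀ * Q) + 10 * ε)) := by
    intro z
    by_cases hz0 : ζ z = 0
    · rw [hz0, zero_mul, zero_mul]
    · have hmem : z ∈ ζ.support := (PMF.mem_support_iff _ _).2 hz0
      refine mul_le_mul_right (ENNReal.ofReal_le_ofReal ?_) _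
      refine (statDist_pi_le_sum _ _).trans ?_
      rw [Finset.sum_const, Finset.card_univ, Fintype.card_fin, nsmul_eq_mul]
      refine mul_le_mul_of_nonneg_left ?_ (Nat.cast_nonneg m)
      have hαz : 0 < rate z := hα₀.trans_le (hrate z hmem)
      refine (statDist_switchSample_lwe_le hn hε hε' hr hαz z (hB z hmem)).trans ?_
      have hQ : (0 : ℝ) < Q := by exact_mod_cast Nat.pos_of_ne_zero (NeZero.ne Q)
      have h1 : 2 / (rate z * Q) ≤ 2 / (α₀ * Q) := by
        apply div_le_div_of_nonneg_left (by norm_num) (by positivity)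
        exact mul_le_mul_of_nonneg_right (hrate z hmem) hQ.le
      linarith
  calc (∑' z, ζ z * ENNReal.ofReal _).toReal ≤ (∑' z, ζ z * ENNReal.ofReal (m * (2 / (α₀ * Q) + 10 * ε))).toReal := by
        refine ENNReal.toReal_mono ?_ (ENNReal.tsum_le_tsum hz)
        rw [ENNReal.tsum_mul_right, ζ.tsum_coe, one_mul]
        exact ENNReal.ofReal_ne_top
    _ = m * (2 / (α₀ * Q) + 10 * ε) := by
        rw [ENNReal.tsum_mul_right, ζ.tsum_coe, one_mul, ENNReal.toReal_ofReal (by positivity)]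

end Outputs

/-! ### Tests: the reduction composed with a distinguisher of the target samples -/

section Tests

variable (n Q q' : ℕ) [NeZero Q] [NeZero q'] (r B τ : ℝ) (t : Fin n → ZMod q') (m : ℕ)

/-- The reduction's output on a tuple of discretised samples, as a PMF. [folklore] -/
def switchKernelPMF (S : Fin m → (Fin n → ZMod Q) × ZMod Q) : PMF (Fin m → (Fin n → ZMod q') × ZMod q') :=
  (piKernel (switchPoint n Q q' r B τ t) m S).toPMF

/-- **The composed test**: reduce, then run the test `D` of the target samples. [cite: BrakerskiEtAl2013, §2 ("transformation reductions")] -/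
def switchTest (D : (Fin m → (Fin n → ZMod q') × ZMod q') → PMF Bool) : (Fin m → (Fin n → ZMod Q) × ZMod Q) → PMF Bool :=
  fun S => (switchKernelPMF n Q q' r B τ t m S).bind D

variable {n Q q' r B τ t m}

/-- An acceptance probability as an integral of the acceptance function. [folklore] -/
theorem toReal_acceptProb_eq_lintegral {Y : Type} [MeasurableSpace Y] [MeasurableSingletonClass Y] [Countable Y] (D : Y → PMF Bool) (P : PMF Y) :
    (LWE.acceptProb D P).toReal = (∫⁻ y, D y true ∂P.toMeasure).toReal := by
  rw [LWE.acceptProb, PMF.bind_apply, lintegral_countable']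
  congr 1
  refine tsum_congr fun y => ?_
  rw [PMF.toMeasure_apply_singleton _ _ (measurableSet_singleton _), mul_comm]

/-- **The acceptance probability of the composed test is the integral of `D`'s acceptance function against
the outputs.** [folklore] -/
theorem toReal_acceptProb_switchTest (D : (Fin m → (Fin n → ZMod q') × ZMod q') → PMF Bool) (P : PMF (Fin m → (Fin n → ZMod Q) × ZMod Q)) :
    (LWE.acceptProb (switchTest n Q q' r B τ t m D) P).toReal = (∫⁻ T, D T true ∂switchOutputs n Q q' r B τ t m P).toReal := by
  rw [toReal_acceptProb_eq_lintegral, switchOutputs, Measure.lintegral_bind (measurable_piKernel measurable_switchPoint m).aemeasurable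
    (measurable_of_countable _).aemeasurable]
  congr 1
  refine lintegral_congr fun S => ?_
  show (((switchKernelPMF n Q q' r B τ t m S).bind D) true : ℝ≥0∞) = _
  rw [PMF.bind_apply, lintegral_countable']
  refine tsum_congr fun T => ?_
  rw [switchKernelPMF, Measure.toPMF_apply, mul_comm]

/-- **Advantage transfer through the reduction**: if the outputs on `P₁, P₂` are `d₁, d₂`-close to the
targets `T₁, T₂`, every test `D` of the targets gives the composed test an advantage at least
`Adv[D] - (d₁ + d₂)`. [cite: BrakerskiEtAl2013, Cor. 3.2 (advantage form)] -/
theorem advantage_transfer (D : (Fin m → (Fin n → ZMod q') × ZMod q') → PMF Bool)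
    (P₁ P₂ : PMF (Fin m → (Fin n → ZMod Q) × ZMod Q)) (T₁ T₂ : PMF (Fin m → (Fin n → ZMod q') × ZMod q')) {d₁ d₂ : ℝ}
    (h₁ : statDist (switchOutputs n Q q' r B τ t m P₁) T₁.toMeasure ≤ d₁) (h₂ : statDist (switchOutputs n Q q' r B τ t m P₂) T₂.toMeasure ≤ d₂) :
    |(LWE.acceptProb D T₁).toReal - (LWE.acceptProb D T₂).toReal| - (d₁ + d₂) ≤
      |(LWE.acceptProb (switchTest n Q q' r B τ t m D) P₁).toReal - (LWE.acceptProb (switchTest n Q q' r B τ t m D) P₂).toReal| := by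
  have hf : Measurable fun T : Fin m → (Fin n → ZMod q') × ZMod q' => (D T true : ℝ≥0∞) := measurable_of_countable _
  have hf1 : ∀ T : Fin m → (Fin n → ZMod q') × ZMod q', (D T true : ℝ≥0∞) ≤ 1 := fun T => PMF.coe_le_one _ _
  rw [toReal_acceptProb_switchTest, toReal_acceptProb_switchTest, toReal_acceptProb_eq_lintegral, toReal_acceptProb_eq_lintegral]
  have e₁ := abs_toReal_lintegral_sub_le_statDist (switchOutputs n Q q' r B τ t m P₁) T₁.toMeasure hf hf1
  have e₂ := abs_toReal_lintegral_sub_le_statDist (switchOutputs n Q q' r B τ t m P₂) T₂.toMeasure hf hf1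
  have := abs_sub_abs_le_abs_sub ((∫⁻ T, D T true ∂T₁.toMeasure).toReal - (∫⁻ T, D T true ∂T₂.toMeasure).toReal)
    ((∫⁻ T, D T true ∂switchOutputs n Q q' r B τ t m P₁).toReal - (∫⁻ T, D T true ∂switchOutputs n Q q' r B τ t m P₂).toReal)
  rw [abs_sub_comm] at e₁ e₂
  have h3 : |((∫⁻ T, D T true ∂T₁.toMeasure).toReal - (∫⁻ T, D T true ∂T₂.toMeasure).toReal) -
      ((∫⁻ T, D T true ∂switchOutputs n Q q' r B τ t m P₁).toReal - (∫⁻ T, D T true ∂switchOutputs n Q q' r B τ t m P₂).toReal)| ≤ d₁ + d₂ := by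
    calc _ = |((∫⁻ T, D T true ∂T₁.toMeasure).toReal - (∫⁻ T, D T true ∂switchOutputs n Q q' r B τ t m P₁).toReal) -
          ((∫⁻ T, D T true ∂T₂.toMeasure).toReal - (∫⁻ T, D T true ∂switchOutputs n Q q' r B τ t m P₂).toReal)| := by ring_nf
      _ ≤ _ := abs_sub _ _
      _ ≤ d₁ + d₂ := add_le_add (e₁.trans h₁) (e₂.trans h₂)
  linarith

/-- **Cor. 3.2 between discretised interfaces (with secret shift `t` and noise raising `τ`), advantage form.**
For every test `D` of `m` samples mod `q'`, the composed test `𝒜 = D ∘ (reduction)` of `m` samples mod `Q`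
satisfies `Adv[D : LWE_{n,m,q',switched,+t}(ζ) vs U] - (m(2/(α₀Q) + 10ε) + 4εm) ≤ Adv[𝒜 : LWE_{n,m,Q,≤}(ζ) vs U]`.
[cite: BrakerskiEtAl2013, Cor. 3.2 with Lemma 2.15] -/
theorem corollary_3_2_discrete {ε α₀ : ℝ} (hn : 0 < n) (hε : 0 < ε) (hε' : ε ≤ 1 / 2)
    (hr : max (Q : ℝ)⁻¹ (q' : ℝ)⁻¹ * Real.sqrt (2 * Real.log (2 * n * (1 + 1 / ε)) / π) ≤ r) (hα₀ : 0 < α₀)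
    (ζ : PMF (Fin n → ℤ)) (rate : (Fin n → ℤ) → ℝ) (hrate : ∀ z ∈ ζ.support, α₀ ≤ rate z)
    (hB : ∀ z ∈ ζ.support, ‖intVecToEuclidean n z‖ ≤ B) (D : (Fin m → (Fin n → ZMod q') × ZMod q') → PMF Bool) :
    |(LWE.acceptProb D (lweMix q' m ζ (fun z => Real.sqrt (Real.sqrt (rate z ^ 2 + r ^ 2 * (‖intVecToEuclidean n z‖ ^ 2 + B ^ 2)) ^ 2 + τ ^ 2)) t)).toReal -
        (LWE.acceptProb D (LWE.uniformSamples (Fin n) (ZMod q') m)).toReal| - (m * (2 / (α₀ * Q) + 10 * ε) + m * (4 * ε)) ≤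
      |(LWE.acceptProb (switchTest n Q q' r B τ t m D) (lweMix Q m ζ rate 0)).toReal -
        (LWE.acceptProb (switchTest n Q q' r B τ t m D) (LWE.uniformSamples (Fin n) (ZMod Q) m)).toReal| :=
  advantage_transfer D _ _ _ _ (statDist_switchOutputs_lwe_le hn hε hε' hr hα₀ ζ rate hrate hB) (statDist_switchOutputs_uniform_le hn hε hε' hr)

end Tests

end BLPRS2013

end Literature.Computability.Cryptography

end
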